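import Summits.Ventures.Crystal3D.Theorems.StickyWulffConstantCoaxialWallLawPayerTransCellGenericExport
import Summits.Ventures.Crystal3D.Theorems.StickyWulffConstantCoaxialWallLawPayerTransMulti
import HarnessLib

/-!
# End accounting, census-free, multi-source IV″: the TOP plate's pooled end pairs of a generic translation pair

HONEST FRAMING. Part of the venture `Summits/Ventures/Crystal3D` (cell `crystal3d-full`), helper for the crux
`CoaxialWallLaw` (stmt-Ventures-19481) of `route-Ventures-StickyWulffConstant`, REGISTERED line `WallLedgerF`
(planner cf-p1), open stub `stub_coaxialTwoSlabAdhesion` (general fillings).  Rung credit only; F-C1 not moved.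
Memo HOME/wall-19481-p2/F-NEXT-SPEC.md §S1 (19481-p2 g4), planner (xxv).  `wordNet_trans_endPairs_generic_multi`
(`…PayerTransCellGenericExport`) applied to the MIRROR IMAGE of the translation cell under `M : (x, y, z) ↦ (x, y, h − z)`
(frame `S ∘ G₀`, `S = (x, y, z) ↦ (x, y, −z)`, offsets `M s₂, M s₁`, plates swapped; the generic-offset hypothesis and
the upward bond flux `Σ_{rising} (G₀ r)₂` are mirror-invariant), with the exported end pairs pulled back through `M` into
`X × X`: pairs in `X` at distance `1` with the CLOSED-ABOVE window `−R₀−1 ≤ b₂ ≤ h+R₀+1`, the two-payer property, and the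
3-adic invariant of the end ball with respect to the TOP offset: `3^k (b − s₂) ∈ G₀ Λ₀` (`wordNet_trans_endPairs_generic_top`).

WHAT THIS IS NOT: not the two-plate cell (next file: union with the bottom pairs, disjoint by the invariants); F-C1 not moved.
-/

noncomputable section

namespace Summit.Ventures.Crystal3D.Theorems

open Summit.Ventures.Crystal3D Finset
open Literature.MathematicalPhysics.StatisticalMechanics (fccStacking)
open scoped InnerProductSpace

open scoped Classical in
/-- **The top plate's pooled end pairs of a generic translation pair, pulled back.**  See the module docstring. -/
theorem wordNet_trans_endPairs_generic_top
    {δ : ℝ} (hg : KissingGap δ) (hc : KissingClassification δ)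
    (G₀ : EuclideanSpace ℝ (Fin 3) ≃ₗᵢ[ℝ] EuclideanSpace ℝ (Fin 3))
    (s₁ s₂ : EuclideanSpace ℝ (Fin 3)) (X P₁ P₂ : Finset (EuclideanSpace ℝ (Fin 3))) (R₀ h ρ : ℝ)
    (hR₀ : 10 ≤ R₀) (hh : 0 ≤ h) (hρ : R₀ ≤ ρ)
    (hX : ∀ p ∈ X, ∀ q ∈ X, p ≠ q → 1 ≤ dist p q)
    (hcell : ∀ p ∈ X, -(2 * R₀) ≤ p 2 ∧ p 2 ≤ h + 2 * R₀ ∧ p 0 ^ 2 + p 1 ^ 2 ≤ ρ ^ 2)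
    (hP₁X : P₁ ⊆ X) (hP₂X : P₂ ⊆ X)
    (hP₁ : ∀ p, p ∈ P₁ ↔ (p ∈ (fun q => G₀ q + s₁) '' fccStacking 1 (Real.sqrt (2 / 3)) ∧
      -(2 * R₀) ≤ p 2 ∧ p 2 ≤ -R₀ ∧ p 0 ^ 2 + p 1 ^ 2 ≤ ρ ^ 2))
    (hP₂ : ∀ p, p ∈ P₂ ↔ (p ∈ (fun q => G₀ q + s₂) '' fccStacking 1 (Real.sqrt (2 / 3)) ∧
      h + R₀ ≤ p 2 ∧ p 2 ≤ h + 2 * R₀ ∧ p 0 ^ 2 + p 1 ^ 2 ≤ ρ ^ 2))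
    (hgen : ∀ k : ℕ, ∀ q ∈ fccStacking 1 (Real.sqrt (2 / 3)), ((3 : ℝ) ^ k) • (s₂ - s₁) ≠ G₀ q) :
    ∃ T : Finset (EuclideanSpace ℝ (Fin 3) × EuclideanSpace ℝ (Fin 3)),
      Real.sqrt 2 * (∑ r ∈ fccSlots.filter (fun r => 0 < (G₀ r) 2), (G₀ r) 2) * Real.pi * ρ ^ 2 -
          12 * (12 * Real.sqrt 2 * Real.pi + 36 * R₀ + 55440) * ρ ≤ (T.card : ℝ) ∧
      (∀ bq ∈ T, bq.1 ∈ X ∧ bq.2 ∈ X ∧ dist bq.1 bq.2 = 1 ∧ -R₀ - 1 ≤ bq.1 2 ∧ bq.1 2 ≤ h + R₀ + 1) ∧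
      (∀ bq ∈ T, (X.filter fun q => dist bq.1 q = 1).card ≤ 11 ∨
        ∃ z₁ ∈ X, ∃ z₂ ∈ X, z₁ ≠ z₂ ∧ dist bq.1 z₁ = 1 ∧ dist bq.1 z₂ = 1 ∧
          (X.filter fun q => dist z₁ q = 1).card ≤ 11 ∧ (X.filter fun q => dist z₂ q = 1).card ≤ 11) ∧
      (∀ bq ∈ T, ∃ k : ℕ, ∃ q ∈ fccStacking 1 (Real.sqrt (2 / 3)), ((3 : ℝ) ^ k) • (bq.1 - s₂) = G₀ q) := by
  -- the vertical mirror `S` and the cell mirror `M`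
  set S : EuclideanSpace ℝ (Fin 3) ≃ₗᵢ[ℝ] EuclideanSpace ℝ (Fin 3) :=
    ((ℝ ∙ EuclideanSpace.single (2 : Fin 3) (1 : ℝ)).reflection).trans (LinearIsometryEquiv.neg ℝ) with hS
  have hS_apply : ∀ p, S p = -((ℝ ∙ EuclideanSpace.single (2 : Fin 3) (1 : ℝ)).reflection p) := fun p => rfl
  have hS0 : ∀ p : EuclideanSpace ℝ (Fin 3), S p 0 = p 0 := by
    intro p; rw [hS_apply, PiLp.neg_apply, (halfTurn_coord p).1, neg_neg]
  have hS1 : ∀ p : EuclideanSpace ℝ (Fin 3), S p 1 = p 1 := by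
    intro p; rw [hS_apply, PiLp.neg_apply, (halfTurn_coord p).2.1, neg_neg]
  have hS2 : ∀ p : EuclideanSpace ℝ (Fin 3), S p 2 = -p 2 := by
    intro p; rw [hS_apply, PiLp.neg_apply, (halfTurn_coord p).2.2]
  have hSS : ∀ p, S (S p) = p := by
    intro p
    ext l
    fin_cases l
    · simp only [Fin.zero_eta, Fin.isValue]; rw [hS0, hS0]
    · simp only [Fin.mk_one, Fin.isValue]; rw [hS1, hS1]
    · simp only [Fin.reduceFinMk, Fin.isValue]; rw [hS2, hS2, neg_neg]
  clear_value S
  set cM : EuclideanSpace ℝ (Fin 3) := h • EuclideanSpace.single (2 : Fin 3) (1 : ℝ) with hcM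
  have hc0 : cM 0 = 0 := by simp [hcM]
  have hc1 : cM 1 = 0 := by simp [hcM]
  have hc2 : cM 2 = h := by simp [hcM]
  let M : EuclideanSpace ℝ (Fin 3) → EuclideanSpace ℝ (Fin 3) := fun p => S p + cM
  have hM0 : ∀ p, M p 0 = p 0 := by intro p; simp only [M, PiLp.add_apply, hS0, hc0, add_zero]
  have hM1 : ∀ p, M p 1 = p 1 := by intro p; simp only [M, PiLp.add_apply, hS1, hc1, add_zero]
  have hM2 : ∀ p, M p 2 = h - p 2 := by
    intro p; simp only [M, PiLp.add_apply, hS2, hc2]; ring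
  have hSc : S cM = -cM := by
    ext l; fin_cases l
    · simp only [Fin.zero_eta, Fin.isValue]; rw [hS0, PiLp.neg_apply, hc0, neg_zero]
    · simp only [Fin.mk_one, Fin.isValue]; rw [hS1, PiLp.neg_apply, hc1, neg_zero]
    · simp only [Fin.reduceFinMk, Fin.isValue]; rw [hS2, PiLp.neg_apply]
  have hMM : ∀ p, M (M p) = p := by
    intro p
    simp only [M, map_add, hSS, hSc]; abel
  have hMinj : Function.Injective M := fun p q hpq => by
    have := congrArg M hpq; rwa [hMM, hMM] at this
  have hMdist : ∀ p q, dist (M p) (M q) = dist p q := by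
    intro p q; simp only [M, dist_add_right, LinearIsometryEquiv.dist_map]
  have hMadd : ∀ p w, M (p + w) = M p + S w := by
    intro p w; simp only [M, map_add]; abel
  have hMsubM : ∀ p q, M p - M q = S (p - q) := by
    intro p q; simp only [M, map_sub]; abel
  have hMrad : ∀ p, M p 0 ^ 2 + M p 1 ^ 2 = p 0 ^ 2 + p 1 ^ 2 := by intro p; rw [hM0, hM1]
  -- the mirrored data
  set X' := X.image M with hX'
  have hmemIm : ∀ (Q : Finset (EuclideanSpace ℝ (Fin 3))) p, p ∈ Q.image M ↔ M p ∈ Q := by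
    intro Q p
    rw [mem_image]
    constructor
    · rintro ⟨x, hx, hxp⟩; rw [← hxp, hMM]; exact hx
    · intro hp; exact ⟨M p, hp, hMM p⟩
  have hmemX' : ∀ p, p ∈ X' ↔ M p ∈ X := hmemIm X
  have hX'sep : ∀ p ∈ X', ∀ q ∈ X', p ≠ q → 1 ≤ dist p q := by
    intro p hp q hq hpq
    rw [← hMdist]
    exact hX _ ((hmemX' p).1 hp) _ ((hmemX' q).1 hq) (fun h' => hpq (hMinj h'))
  have hcell' : ∀ p ∈ X', -(2 * R₀) ≤ p 2 ∧ p 2 ≤ h + 2 * R₀ ∧ p 0 ^ 2 + p 1 ^ 2 ≤ ρ ^ 2 := by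
    intro p hp
    obtain ⟨h1, h2, h3⟩ := hcell _ ((hmemX' p).1 hp)
    rw [hM2] at h1 h2; rw [hMrad] at h3
    exact ⟨by linarith, by linarith, h3⟩
  set G' : EuclideanSpace ℝ (Fin 3) ≃ₗᵢ[ℝ] EuclideanSpace ℝ (Fin 3) := G₀.trans S with hG'
  have hG'ap : ∀ x, G' x = S (G₀ x) := fun x => rfl
  clear_value G'
  have hlat : ∀ (s p : EuclideanSpace ℝ (Fin 3)),
      M p ∈ (fun q => G₀ q + s) '' fccStacking 1 (Real.sqrt (2 / 3)) ↔
        p ∈ (fun q => G' q + M s) '' fccStacking 1 (Real.sqrt (2 / 3)) := by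
    intro s p
    simp only [Set.mem_image, hG'ap]
    constructor
    · rintro ⟨q, hq, hqp⟩
      refine ⟨q, hq, ?_⟩
      have hqp' : s + G₀ q = M p := by rw [add_comm]; exact hqp
      have := congrArg M hqp'
      rw [hMM, hMadd] at this
      rw [add_comm]; exact this
    · rintro ⟨q, hq, hqp⟩
      refine ⟨q, hq, ?_⟩
      rw [← hqp, show S (G₀ q) + M s = M (s + G₀ q) by rw [hMadd, add_comm], hMM, add_comm]
  have hP₁' : ∀ p, p ∈ P₂.image M ↔ (p ∈ (fun q => G' q + M s₂) '' fccStacking 1 (Real.sqrt (2 / 3)) ∧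
      -(2 * R₀) ≤ p 2 ∧ p 2 ≤ -R₀ ∧ p 0 ^ 2 + p 1 ^ 2 ≤ ρ ^ 2) := by
    intro p
    rw [hmemIm, hP₂, hM2, hMrad, hlat]
    constructor
    · rintro ⟨h1, h2, h3, h4⟩; exact ⟨h1, by linarith, by linarith, h4⟩
    · rintro ⟨h1, h2, h3, h4⟩; exact ⟨h1, by linarith, by linarith, h4⟩
  have hP₂' : ∀ p, p ∈ P₁.image M ↔ (p ∈ (fun q => G' q + M s₁) '' fccStacking 1 (Real.sqrt (2 / 3)) ∧
      h + R₀ ≤ p 2 ∧ p 2 ≤ h + 2 * R₀ ∧ p 0 ^ 2 + p 1 ^ 2 ≤ ρ ^ 2) := by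
    intro p
    rw [hmemIm, hP₁, hM2, hMrad, hlat]
    constructor
    · rintro ⟨h1, h2, h3, h4⟩; exact ⟨h1, by linarith, by linarith, h4⟩
    · rintro ⟨h1, h2, h3, h4⟩; exact ⟨h1, by linarith, by linarith, h4⟩
  have hP₁'X : P₂.image M ⊆ X' := image_subset_image hP₂X
  have hP₂'X : P₁.image M ⊆ X' := image_subset_image hP₁X
  have hgen' : ∀ k : ℕ, ∀ q ∈ fccStacking 1 (Real.sqrt (2 / 3)), ((3 : ℝ) ^ k) • (M s₁ - M s₂) ≠ G' q := by
    intro k q hq heq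
    rw [hMsubM, hG'ap, ← LinearIsometryEquiv.map_smul] at heq
    have h1 := congrArg S heq
    rw [hSS, hSS] at h1
    refine hgen k (-q) (fcc_neg_mem hq) ?_
    rw [map_neg, ← h1, ← smul_neg, neg_sub]
  -- the mirrored cell's export
  obtain ⟨T', hflux', hTpair', hTpay', hTinv'⟩ :=
    wordNet_trans_endPairs_generic_multi hg hc G' (M s₂) (M s₁) X' (P₂.image M) (P₁.image M) R₀ h ρ hR₀ hh hρ
      hX'sep hcell' hP₁'X hP₂'X hP₁' hP₂' hgen'
  -- the rising flux of `G' = S ∘ G₀` is the rising flux of `G₀`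
  have hsum : ∑ r ∈ fccSlots.filter (fun r => 0 < (G' r) 2), (G' r) 2 =
      ∑ r ∈ fccSlots.filter (fun r => 0 < (G₀ r) 2), (G₀ r) 2 := by
    have h1 : fccSlots.filter (fun r => 0 < (G' r) 2) = (fccSlots.filter (fun r => 0 < (G₀ r) 2)).image (fun r => -r) := by
      ext r
      rw [mem_filter, mem_image]
      constructor
      · rintro ⟨hr, hpos⟩
        refine ⟨-r, mem_filter.2 ⟨neg_mem_fccSlots hr, ?_⟩, neg_neg r⟩
        rw [hG'ap, hS2] at hpos
        rw [map_neg, PiLp.neg_apply]; exact hpos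
      · rintro ⟨r', hr', rfl⟩
        obtain ⟨hr'S, hpos⟩ := mem_filter.1 hr'
        refine ⟨neg_mem_fccSlots hr'S, ?_⟩
        rw [hG'ap, hS2, map_neg, PiLp.neg_apply, neg_neg]; exact hpos
    rw [h1, sum_image (fun a _ b _ hab => neg_injective hab)]
    refine sum_congr rfl fun r _ => ?_
    rw [hG'ap, hS2, map_neg, PiLp.neg_apply, neg_neg]
  rw [hsum] at hflux'
  -- pull the pairs back
  set T : Finset (EuclideanSpace ℝ (Fin 3) × EuclideanSpace ℝ (Fin 3)) := T'.image (fun bq => (M bq.1, M bq.2)) with hT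
  have hPinj : Function.Injective (fun bq : EuclideanSpace ℝ (Fin 3) × EuclideanSpace ℝ (Fin 3) => (M bq.1, M bq.2)) := by
    intro a b hab
    simp only [Prod.mk.injEq] at hab
    exact Prod.ext (hMinj hab.1) (hMinj hab.2)
  have hTcard : T.card = T'.card := card_image_of_injective _ hPinj
  have hdeg : ∀ b, (X'.filter fun q => dist b q = 1).card = (X.filter fun q => dist (M b) q = 1).card := by
    intro b
    have : (X.filter fun q => dist (M b) q = 1) = (X'.filter fun q => dist b q = 1).image M := by
      ext q
      rw [mem_filter, mem_image]
      constructor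
      · rintro ⟨hq, hd⟩
        refine ⟨M q, mem_filter.2 ⟨(hmemX' _).2 (by rw [hMM]; exact hq), ?_⟩, hMM q⟩
        rw [← hMdist, hMM]; exact hd
      · rintro ⟨q', hq', rfl⟩
        obtain ⟨hq'X, hd⟩ := mem_filter.1 hq'
        exact ⟨(hmemX' q').1 hq'X, by rw [hMdist]; exact hd⟩
    rw [this, card_image_of_injective _ hMinj]
  refine ⟨T, by rw [hTcard]; exact hflux', ?_, ?_, ?_⟩
  · intro bq hbq
    obtain ⟨bq', hbq', rfl⟩ := mem_image.1 hbq
    obtain ⟨h1, h2, h3, h4, h5⟩ := hTpair' bq' hbq'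
    refine ⟨(hmemX' _).1 h1, (hmemX' _).1 h2, by show dist (M bq'.1) (M bq'.2) = 1; rw [hMdist]; exact h3, ?_, ?_⟩
    · show -R₀ - 1 ≤ M bq'.1 2; rw [hM2]; linarith
    · show M bq'.1 2 ≤ h + R₀ + 1; rw [hM2]; linarith
  · intro bq hbq
    obtain ⟨bq', hbq', rfl⟩ := mem_image.1 hbq
    rcases hTpay' bq' hbq' with h11 | ⟨z₁, hz₁, z₂, hz₂, hne, hd₁, hd₂, hc₁, hc₂⟩
    · left; show (X.filter fun q => dist (M bq'.1) q = 1).card ≤ 11; rw [← hdeg]; exact h11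
    · right
      refine ⟨M z₁, (hmemX' _).1 hz₁, M z₂, (hmemX' _).1 hz₂, fun h' => hne (hMinj h'), ?_, ?_, ?_, ?_⟩
      · show dist (M bq'.1) (M z₁) = 1; rw [hMdist]; exact hd₁
      · show dist (M bq'.1) (M z₂) = 1; rw [hMdist]; exact hd₂
      · rw [← hdeg]; exact hc₁
      · rw [← hdeg]; exact hc₂
  · intro bq hbq
    obtain ⟨bq', hbq', rfl⟩ := mem_image.1 hbq
    obtain ⟨k, q, hq, hkq⟩ := hTinv' bq' hbq'
    refine ⟨k, q, hq, ?_⟩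
    show ((3 : ℝ) ^ k) • (M bq'.1 - s₂) = G₀ q
    have e : M bq'.1 - s₂ = S (bq'.1 - M s₂) := by rw [← hMsubM, hMM]
    rw [e, ← LinearIsometryEquiv.map_smul, hkq, hG'ap, hSS]

end Summit.Ventures.Crystal3D.Theorems

end
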